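import Literature.Geometry.Lorentzian.CoordRoundDefectTensor
import HarnessLib

/-!
# The evolution inequality of the round defect `|Rm − a(t) g ⊙ g|²` under the Ricci flow, in coordinates

Support file (everything PROVED; no definition, no named fact) for **Hamilton 1982, §17, Thm. 17.6**
(smooth convergence of the normalised flow to the round metric: the squared norm of the round
defect tensor `T = Rm − a(t) (g ⊙ g)` with a reference sectional curvature `a` depending on time
only satisfies a heat inequality whose reaction term vanishes to first order at the round tensor),
wanted by the crux `ChangGurskyYang` of route `SmoothPoincare4/EntropyRung`
(item stmt-SmoothPoincare4-10834, line `margerin-cone-hamilton-rails`, stub `stub_smoothRoundLimit`).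
In the chart calculus of `MetricCoord`, along `∂G/∂t = −2 Ric(G)` on `V × S`:

* `IsMetricFamilyOn.tder_ggKN` — `∂_t (g ⊙ g) = −2 (Ric ⊙ g + g ⊙ Ric)` in components, and
  `IsMetricFamilyOn.sqrt_tnormSq_tder_ggKN_le` — `|∂_t (g ⊙ g)| ≤ 8n √|Rm|²`;
* **`IsMetricFamilyOn.derivWithin_tnormSq_roundDefect_le`** — for `a` smooth on `S` there is
  `C ≥ 0` with, at every positive definite `(t, y) ∈ S × V`,
  `∂_t|T|² ≤ Δ|T|² − 2|∇Rm|² + C (|Rm|² + |a'| + |a| √|Rm|²) |T| + C √|Rm|² |T|²`,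
  `T = Rm − a (g ⊙ g)`: since `∇(g ⊙ g) = 0` and `a` is constant in space, `∇T = ∇Rm` and
  `ΔT = ΔRm`, so `∂_t|T|² − Δ|T|² + 2|∇T|² = 2⟨(∂_t − Δ)Rm − a' g ⊙ g − a ∂_t(g ⊙ g), T⟩ + 2Σ⟨Ric⋆T, T⟩`
  (`hasDerivWithinAt_tnormSq_ricciFlow`, `lapAt_tnormSq`), with `(∂_t − Δ)Rm = Rm * Rm`
  (`starQuad_curvL`, `StarQuad.norm_le`) and Cauchy–Schwarz.

## References

* R. S. Hamilton, *Three-manifolds with positive Ricci curvature*, J. Differential Geom. 17 (1982)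
  255–306, §17, Lemma 17.5, Thm. 17.6. [Hamilton1982]
* P. Topping, *Lectures on the Ricci flow*, LMS Lecture Note Series 325, CUP 2006, Prop. 2.5.1,
  Prop. 3.2.10, §3.3. [Topping2006]
-/

noncomputable section

set_option maxSynthPendingDepth 3

open Set Filter ContinuousLinearMap Module Function
open scoped Topology ContDiff

namespace Literature.Geometry.Lorentzian

namespace MetricCoord

namespace IsMetricFamilyOn

variable {E : Type*} [NormedAddCommGroup E] [NormedSpace ℝ E] {ι : Type*} [Fintype ι]
  {G : ℝ → E → E →L[ℝ] E →L[ℝ] ℝ} {S : Set ℝ} {V : Set E} {x : E} {t : ℝ}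
  (b : Basis ι ℝ E) [FiniteDimensional ℝ E] [CompleteSpace E]
  (hG : IsMetricFamilyOn G S V)
  (hfl : ∀ s ∈ S, ∀ y ∈ V, tDeriv G S s y = (-2 : ℝ) • ricAt (G s) y)
  {A : ℝ → E → (Fin 4 → ι) → ℝ}
  (hA : ∀ s y J, A s y J = G s y (b (J 0)) (b (J 3)) * G s y (b (J 1)) (b (J 2))
    - G s y (b (J 0)) (b (J 2)) * G s y (b (J 1)) (b (J 3)))
include hG hA

omit [Fintype ι] [FiniteDimensional ℝ E] [CompleteSpace E] in
/-- The Kulkarni–Nomizu array of a smooth family of metrics is a smooth family. [folklore] -/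
theorem tsmoothFamOn_ggKN : TSmoothFamOn A V S := by
  intro J
  have h : ∀ i j, ContDiffOn ℝ ∞ (fun q : E × ℝ ↦ G q.2 q.1 (b i) (b j)) (V ×ˢ S) := fun i j ↦
    (hG.contDiffOn.clm_apply contDiffOn_const).clm_apply contDiffOn_const
  have hfun : (fun q : E × ℝ ↦ A q.2 q.1 J) = fun q ↦ G q.2 q.1 (b (J 0)) (b (J 3)) * G q.2 q.1 (b (J 1)) (b (J 2))
      - G q.2 q.1 (b (J 0)) (b (J 2)) * G q.2 q.1 (b (J 1)) (b (J 3)) := funext fun q ↦ hA q.2 q.1 J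
  rw [hfun]
  exact ((h _ _).mul (h _ _)).sub ((h _ _).mul (h _ _))

include hfl

omit [Fintype ι] [CompleteSpace E] in
/-- **`∂_t (g ⊙ g) = −2 (Ric ⊙ g + g ⊙ Ric)` in components** along `∂_t G = −2 Ric`.
[cite: Hamilton1982, §17, Lemma 17.5] -/
theorem tder_ggKN (hx : x ∈ V) (ht : t ∈ S) (J : Fin 4 → ι) :
    tder A S t x J = -2 * (ricAt (G t) x (b (J 0)) (b (J 3)) * G t x (b (J 1)) (b (J 2))
      + G t x (b (J 0)) (b (J 3)) * ricAt (G t) x (b (J 1)) (b (J 2))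
      - ricAt (G t) x (b (J 0)) (b (J 2)) * G t x (b (J 1)) (b (J 3))
      - G t x (b (J 0)) (b (J 2)) * ricAt (G t) x (b (J 1)) (b (J 3))) := by
  rw [tder_apply]
  have hfun : (fun s ↦ A s x J) = fun s ↦ G s x (b (J 0)) (b (J 3)) * G s x (b (J 1)) (b (J 2))
      - G s x (b (J 0)) (b (J 2)) * G s x (b (J 1)) (b (J 3)) := funext fun s ↦ hA s x J
  have hd : ∀ v w, HasDerivWithinAt (fun s ↦ G s x v w) (-2 * ricAt (G t) x v w) S t := by
    intro v w
    have h := hG.hasDerivWithinAt_apply₂ hx ht v w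
    rw [hfl t ht x hx] at h
    simpa only [FunLike.coe_smul, Pi.smul_apply, smul_eq_mul] using h
  rw [hfun]
  refine ((((hd (b (J 0)) (b (J 3))).mul (hd (b (J 1)) (b (J 2)))).sub
    ((hd (b (J 0)) (b (J 2))).mul (hd (b (J 1)) (b (J 3))))).congr_deriv ?_).derivWithin
    (hG.uniqueDiffOn t ht)
  ring

omit [CompleteSpace E] in
/-- **`|∂_t (g ⊙ g)| ≤ 8n √|Rm|²`** along `∂_t G = −2 Ric` at positive definite points
(`|Ric ⊗ g| = |Ric| |g| = √n |Ric|`, `|Ric|² ≤ n |Rm|²`). [cite: Hamilton1982, §17, Lemma 17.5] -/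
theorem sqrt_tnormSq_tder_ggKN_le (hx : x ∈ V) (ht : t ∈ S) (hpos : ∀ v, v ≠ 0 → 0 < G t x v v) :
    Real.sqrt (tnormSq (G t) b (tder A S t) x) ≤
      8 * Fintype.card ι * Real.sqrt (tnormSq (G t) b (rm4 (G t) b) x) := by
  classical
  have hGt := hG.isMetricOn t ht
  have hs := hGt.symm x hx
  have hi := hGt.isInvertible x hx
  set n : ℝ := (Fintype.card ι : ℝ) with hn
  have hn0 : 0 ≤ n := Nat.cast_nonneg _
  set u0 := tnormSq (G t) b (rm4 (G t) b) x with hu0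
  have hu0n : 0 ≤ u0 := tnormSq_nonneg b hs hpos _
  set R2 : E → (Fin 2 → ι) → ℝ := ric2 (G t) b with hR2
  set g2 : E → (Fin 2 → ι) → ℝ := fun y I ↦ G t y (b (I 0)) (b (I 1)) with hg2
  set e₁ : Fin 2 ⊕ Fin 2 ≃ Fin 4 := ⟨Sum.elim ![0, 3] ![1, 2], ![Sum.inl 0, Sum.inr 0, Sum.inr 1, Sum.inl 1],
    by rintro (i | i) <;> fin_cases i <;> rfl, by intro i; fin_cases i <;> rfl⟩ with he₁
  set e₂ : Fin 2 ⊕ Fin 2 ≃ Fin 4 := ⟨Sum.elim ![0, 2] ![1, 3], ![Sum.inl 0, Sum.inr 0, Sum.inl 1, Sum.inr 1],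
    by rintro (i | i) <;> fin_cases i <;> rfl, by intro i; fin_cases i <;> rfl⟩ with he₂
  set Y : E → (Fin 4 → ι) → ℝ := treindex e₁ (tprod R2 g2) + treindex e₁ (tprod g2 R2)
    - treindex e₂ (tprod R2 g2) - treindex e₂ (tprod g2 R2) with hY
  have hpt : ∀ J, tder A S t x J = ((-2 : ℝ) • Y) x J := by
    intro J
    rw [hG.tder_ggKN b hfl hA hx ht J]
    simp only [hY, Pi.smul_apply, Pi.add_apply, Pi.sub_apply, treindex_apply, tprod_apply, smul_eq_mul,
      hR2, hg2, ric2, he₁, he₂, Equiv.coe_fn_mk, Function.comp_apply, Sum.elim_inl, Sum.elim_inr,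
      Matrix.cons_val_zero, Matrix.cons_val_one]
  rw [tnormSq_congr_point b hpt, tnormSq_smul, Real.sqrt_mul (sq_nonneg _), Real.sqrt_sq_eq_abs,
    show |(-2 : ℝ)| = 2 by norm_num]
  -- the four pieces
  have hg2n : tnormSq (G t) b g2 x = n := tnormSq_metric2 b hs hpos
  have hR2n : tnormSq (G t) b R2 x ≤ n * u0 := by
    have h2 : tnormSq (G t) b R2 x = tnormSq (G t) b (ttr (G t) b (treindex ricTraceEquiv (rm4 (G t) b))) x :=
      tnormSq_congr_point b fun I ↦ ric2_eq_ttr b hi I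
    rw [h2]
    refine (tnormSq_ttr_le b hs hpos _).trans ?_
    rw [tnormSq_treindex]
  have hterm : ∀ P Q : E → (Fin 2 → ι) → ℝ, tnormSq (G t) b P x * tnormSq (G t) b Q x ≤ n * n * u0 →
      ∀ e : Fin 2 ⊕ Fin 2 ≃ Fin 4, Real.sqrt (tnormSq (G t) b (treindex e (tprod P Q)) x) ≤ n * Real.sqrt u0 := by
    intro P Q hPQ e
    rw [tnormSq_treindex, tnormSq_tprod]
    calc Real.sqrt (tnormSq (G t) b P x * tnormSq (G t) b Q x)
        ≤ Real.sqrt (n * n * u0) := Real.sqrt_le_sqrt hPQ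
      _ = n * Real.sqrt u0 := by rw [Real.sqrt_mul (mul_self_nonneg n), Real.sqrt_mul_self hn0]
  have hRg : tnormSq (G t) b R2 x * tnormSq (G t) b g2 x ≤ n * n * u0 := by
    rw [hg2n]; nlinarith [hR2n, hn0]
  have hgR : tnormSq (G t) b g2 x * tnormSq (G t) b R2 x ≤ n * n * u0 := by
    rw [hg2n]; nlinarith [hR2n, hn0]
  have h1 := hterm R2 g2 hRg e₁
  have h2 := hterm g2 R2 hgR e₁
  have h3 := hterm R2 g2 hRg e₂
  have h4 := hterm g2 R2 hgR e₂
  have t1 := sqrt_tnormSq_sub_le b hs hpos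
    (treindex e₁ (tprod R2 g2) + treindex e₁ (tprod g2 R2) - treindex e₂ (tprod R2 g2)) (treindex e₂ (tprod g2 R2))
  have t2 := sqrt_tnormSq_sub_le b hs hpos (treindex e₁ (tprod R2 g2) + treindex e₁ (tprod g2 R2))
    (treindex e₂ (tprod R2 g2))
  have t3 := sqrt_tnormSq_add_le b hs hpos (treindex e₁ (tprod R2 g2)) (treindex e₁ (tprod g2 R2))
  rw [hY]
  linarith

/-- **The evolution inequality of the round defect** (Hamilton 1982, §17, the computation behind
Thm. 17.6, for a general reference curvature `a(t)`): along `∂G/∂t = −2 Ric(G)` on `V × S`, for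
`a` smooth on `S` and `T(t) = Rm(G t) − a(t) A(t)` (`A = g ⊙ g` the Kulkarni–Nomizu array of the
metric), there is `C ≥ 0` with, at every `(t, y) ∈ S × V` where `G t y` is positive definite,
`∂_t|T|² ≤ Δ|T|² − 2|∇Rm|² + C (|Rm|² + |a'(t)| + |a(t)| √|Rm|²) |T| + C √|Rm|² |T|²`
(`∂_t` within `S`, `Δ = lapAt`, `|∇Rm|² = |curvD 1|²`): `∇A = 0`, `ΔA = 0`, so
`∂_t|T|² − Δ|T|² + 2|∇T|² = 2⟨(∂_t − Δ)Rm − a'A − a∂_tA, T⟩ + 2Σ_a⟨Ric⋆_a T, T⟩` with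
`|(∂_t − Δ)Rm| ≤ C₀|Rm|²`, `|A| = √(2n(n−1))`, `|∂_tA| ≤ 8n√|Rm|²`, `|Ric⋆_aT| ≤ n√|Rm|²|T|`.
[cite: Hamilton1982, §17, Thm. 17.6] -/
theorem derivWithin_tnormSq_roundDefect_le (ht₀ : t ∈ S) {a : ℝ → ℝ} (ha : ContDiffOn ℝ ∞ a S) :
    ∃ C : ℝ, 0 ≤ C ∧ ∀ s ∈ S, ∀ y ∈ V, (∀ v, v ≠ 0 → 0 < G s y v v) →
      derivWithin (fun s' ↦ tnormSq (G s') b (rm4 (G s') b - a s' • A s') y) S s ≤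
        lapAt (G s) (tnormSq (G s) b (rm4 (G s) b - a s • A s)) y
        - 2 * tnormSq (G s) b (curvD G b 1 s) y
        + C * (tnormSq (G s) b (rm4 (G s) b) y + |derivWithin a S s|
            + |a s| * Real.sqrt (tnormSq (G s) b (rm4 (G s) b) y))
          * Real.sqrt (tnormSq (G s) b (rm4 (G s) b - a s • A s) y)
        + C * Real.sqrt (tnormSq (G s) b (rm4 (G s) b) y) * tnormSq (G s) b (rm4 (G s) b - a s • A s) y := by
  classical
  obtain ⟨C₀, hC₀, hL⟩ := (hG.starQuad_curvL b hfl ht₀ 0).norm_le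
  set n : ℝ := (Fintype.card ι : ℝ) with hn
  have hn0 : 0 ≤ n := Nat.cast_nonneg _
  set K : ℝ := Real.sqrt (2 * n * (n - 1)) with hK
  have hK0 : 0 ≤ K := Real.sqrt_nonneg _
  refine ⟨2 * C₀ + 2 * K + 16 * n, by positivity, ?_⟩
  intro s hs y hy hpos
  have hGs := hG.isMetricOn s hs
  have hsy := hGs.symm y hy
  have hU := hG.uniqueDiffOn s hs
  -- the families
  have hAfam : TSmoothFamOn A V S := hG.tsmoothFamOn_ggKN b hA
  have hafam : ContDiffOn ℝ ∞ (fun q : E × ℝ ↦ a q.2) (V ×ˢ S) := ha.comp contDiffOn_snd fun q hq ↦ hq.2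
  have hD : TSmoothFamOn (fun s' ↦ rm4 (G s') b - a s' • A s') V S := fun I ↦
    (hG.tsmoothFamOn_rm4 b I).sub (hafam.mul (hAfam I))
  -- (i) the time derivative of `|T|²`
  rw [(hG.hasDerivWithinAt_tnormSq_ricciFlow b hfl hD hy hs).derivWithin hU]
  -- (ii) `∂_t T = ΔRm + (∂_t − Δ)Rm − a'A − a ∂_tA` at `y`
  have ha' : HasDerivWithinAt a (derivWithin a S s) S s := ((ha.differentiableOn (by simp)) s hs).hasDerivWithinAt
  have htD : ∀ I, tder (fun s' ↦ rm4 (G s') b - a s' • A s') S s y I =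
      tlap (G s) b (rm4 (G s) b) y I + curvL G S b 0 s y I
        - (derivWithin a S s * A s y I + a s * tder A S s y I) := by
    intro I
    rw [tder_apply]
    have h1 : HasDerivWithinAt (fun s' ↦ rm4 (G s') b y I) (tder (curvD G b 0) S s y I) S s :=
      (hG.tsmoothFamOn_curvD b 0).hasDerivWithinAt hy hs I
    have h2 : HasDerivWithinAt (fun s' ↦ a s' * A s' y I) (derivWithin a S s * A s y I + a s * tder A S s y I) S s :=
      ha'.mul (hAfam.hasDerivWithinAt hy hs I)
    have h3 := (h1.sub h2).derivWithin hU
    rw [tder_curvD] at h3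
    exact h3
  -- (iii) `∇T = ∇Rm`, `ΔT = ΔRm`
  have hDs : TSmoothOn (rm4 (G s) b - a s • A s) V := hD.slice hs
  have hlapD : ∀ I, tlap (G s) b (rm4 (G s) b - a s • A s) y I = tlap (G s) b (rm4 (G s) b) y I :=
    fun I ↦ hGs.tlap_rm4_sub_smul_ggKN b (hA s) hy (a s) I
  have hlap := hGs.lapAt_tnormSq (b := b) hDs hy
  have hgrad : tnormSq (G s) b (tcov (G s) b (rm4 (G s) b - a s • A s)) y = tnormSq (G s) b (curvD G b 1 s) y := by
    rw [tnormSq_congr_point b (fun J ↦ hGs.tcov_rm4_sub_smul_ggKN b (hA s) hy (a s) J)]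
    change tnormSq (G s) b (tcov (G s) b (curvD G b 0 s)) y = _
    rw [tcov_curvD, tnormSq_treindex]
  rw [hgrad] at hlap
  -- (iv) `⟨∂_t T, T⟩ = ⟨ΔT, T⟩ + ⟨X, T⟩`, `X = (∂_t − Δ)Rm − a'A − a∂_tA`
  have hsplit : tinner (G s) b (tder (fun s' ↦ rm4 (G s') b - a s' • A s') S s) (rm4 (G s) b - a s • A s) y =
      tinner (G s) b (tlap (G s) b (rm4 (G s) b - a s • A s)) (rm4 (G s) b - a s • A s) y
        + tinner (G s) b (curvL G S b 0 s - (derivWithin a S s • A s + a s • tder A S s))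
          (rm4 (G s) b - a s • A s) y := by
    rw [← tinner_add_left]
    simp only [tinner_apply]
    refine Finset.sum_congr rfl fun I _ ↦ Finset.sum_congr rfl fun J _ ↦ ?_
    rw [htD I]
    simp only [Pi.add_apply, Pi.sub_apply, Pi.smul_apply, smul_eq_mul, hlapD I]
    ring
  rw [hsplit]
  -- (v) bounds
  set u0 := tnormSq (G s) b (rm4 (G s) b) y with hu0
  set uD := tnormSq (G s) b (rm4 (G s) b - a s • A s) y with huD
  have hu0n : 0 ≤ u0 := tnormSq_nonneg b hsy hpos _
  have huDn : 0 ≤ uD := tnormSq_nonneg b hsy hpos _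
  have hsq0 : 0 ≤ Real.sqrt u0 := Real.sqrt_nonneg _
  have hsqD : 0 ≤ Real.sqrt uD := Real.sqrt_nonneg _
  have hXn : Real.sqrt (tnormSq (G s) b (curvL G S b 0 s - (derivWithin a S s • A s + a s • tder A S s)) y) ≤
      C₀ * u0 + K * |derivWithin a S s| + 8 * n * |a s| * Real.sqrt u0 := by
    have h1 : Real.sqrt (tnormSq (G s) b (curvL G S b 0 s) y) ≤ C₀ * u0 := by
      have h := hL s hs y hy hsy hpos
      simp only [zero_add, Finset.sum_range_one, Nat.sub_zero, curvD_zero] at h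
      rw [Real.mul_self_sqrt hu0n] at h
      exact h
    have h2 : Real.sqrt (tnormSq (G s) b (derivWithin a S s • A s) y) = |derivWithin a S s| * K := by
      rw [tnormSq_smul, Real.sqrt_mul (sq_nonneg _), Real.sqrt_sq_eq_abs, tnormSq_ggKN b (hA s) hsy hpos]
    have h3 : Real.sqrt (tnormSq (G s) b (a s • tder A S s) y) ≤ |a s| * (8 * n * Real.sqrt u0) := by
      rw [tnormSq_smul, Real.sqrt_mul (sq_nonneg _), Real.sqrt_sq_eq_abs]
      exact mul_le_mul_of_nonneg_left (hG.sqrt_tnormSq_tder_ggKN_le b hfl hA hy hs hpos) (abs_nonneg _)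
    have h4 := sqrt_tnormSq_sub_le b hsy hpos (curvL G S b 0 s) (derivWithin a S s • A s + a s • tder A S s)
    have h5 := sqrt_tnormSq_add_le b hsy hpos (derivWithin a S s • A s) (a s • tder A S s)
    have h6 : |derivWithin a S s| * K = K * |derivWithin a S s| := mul_comm _ _
    linarith
  have hXD : tinner (G s) b (curvL G S b 0 s - (derivWithin a S s • A s + a s • tder A S s))
      (rm4 (G s) b - a s • A s) y ≤
      (C₀ * u0 + K * |derivWithin a S s| + 8 * n * |a s| * Real.sqrt u0) * Real.sqrt uD :=
    (le_abs_self _).trans ((abs_tinner_le b hsy hpos _ _).trans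
      (mul_le_mul_of_nonneg_right hXn (Real.sqrt_nonneg _)))
  have hRb : ∑ c, tinner (G s) b (ricSlot (G s) b (rm4 (G s) b - a s • A s) c) (rm4 (G s) b - a s • A s) y ≤
      4 * (n * Real.sqrt u0 * uD) := by
    have hterm : ∀ c, tinner (G s) b (ricSlot (G s) b (rm4 (G s) b - a s • A s) c) (rm4 (G s) b - a s • A s) y ≤
        n * Real.sqrt u0 * uD := by
      intro c
      refine (le_abs_self _).trans ((abs_tinner_le b hsy hpos _ _).trans ?_)
      have h := hG.sqrt_tnormSq_ricSlot_le b hs hy hpos (rm4 (G s) b - a s • A s) c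
      calc Real.sqrt (tnormSq (G s) b (ricSlot (G s) b (rm4 (G s) b - a s • A s) c) y) * Real.sqrt uD
          ≤ (n * Real.sqrt u0 * Real.sqrt uD) * Real.sqrt uD := mul_le_mul_of_nonneg_right h (Real.sqrt_nonneg _)
        _ = n * Real.sqrt u0 * uD := by rw [mul_assoc, Real.mul_self_sqrt huDn]
    calc ∑ c, tinner (G s) b (ricSlot (G s) b (rm4 (G s) b - a s • A s) c) (rm4 (G s) b - a s • A s) y
        ≤ ∑ _c : Fin 4, n * Real.sqrt u0 * uD := Finset.sum_le_sum fun c _ ↦ hterm c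
      _ = _ := by rw [Finset.sum_const, Finset.card_univ, Fintype.card_fin, nsmul_eq_mul]; norm_num
  -- (vi) assemble
  have p1 : 0 ≤ (2 * K + 16 * n) * (u0 * Real.sqrt uD) := by positivity
  have p2 : 0 ≤ (2 * C₀ + 16 * n) * (|derivWithin a S s| * Real.sqrt uD) := by positivity
  have p3 : 0 ≤ (2 * C₀ + 2 * K) * (|a s| * Real.sqrt u0 * Real.sqrt uD) := by positivity
  have p4 : 0 ≤ (2 * C₀ + 2 * K + 8 * n) * (Real.sqrt u0 * uD) := by positivity
  linarith [hlap, hXD, hRb, p1, p2, p3, p4]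

end IsMetricFamilyOn

end MetricCoord

end Literature.Geometry.Lorentzian

end
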